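import Literature.MathematicalPhysics.QuantumFieldTheory.Balaban1983to89.Node00.Record5C
import Literature.MathematicalPhysics.QuantumFieldTheory.Balaban1983to89.B16NodeKnitRecord5

/-!
# `Balaban1983to89.B16NodeKnitRecord5C` — YM-DAG node N13 · [Balaban1989LargeFieldII] CMP **122** (1989) 355–392, Theorem 1 p. 355 + (0.1),
# Cor. 3 pp. 387 ∕ 391: the N13 knit AT THE RECORD PREDICATE OF RECORD `Node00.IsRecordOfRecord₅C F N D w` (C-binding, pub-ymgap chair
# R434 (Q2) = (C); `Rec₅ := fun F D w => Node00.IsRecordOfRecord₅C F 2 D w`) — the `S_N13 Rec₅C` and `S_N13E Rec₅C` shapes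

statement-level bookkeeping over published theorems with citation tags; kernel-checked compositions of tree theorems;
nothing here is a claim about the Yang–Mills mass gap.

CITATION HEADER (lean-in-tree rule).  Source: T. Bałaban, *Large field renormalization. II. Localization, exponentiation, and bounds for the
𝐑 operation*, Commun. Math. Phys. **122**, 355–392 (1989), doi:10.1007/bf01238433 [Balaban1989LargeFieldII] (cell paper B16 = «[V]»), with
[Balaban1988Convergent] («[III]»: the assumed 𝐑 of p. 244, Cor. 3 (2.50) p. 264).  Seat `pub-ymgap-dag-n13-a` (YM-PLAN Track A, HUMAN RULING D-0062:
the KNIT-BY-NAME seat of node N13; director-ym LINE №12), module 6 of the seat — the twin of module 5 `B16NodeKnitRecord5` (N-binding record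
`IsRecordOfRecord₅`) at THE PREDICATE OF RECORD.  BY NAME and UNCHANGED: `…Node00.Record5C` (seat pub-ymgap-node00-def g28, p411316:
`IsRecordOfRecord₅C`, `upOfRecord₅C`, `upOfRecord₅C_leaves`), `…Node00.Record5` (`Stage5Params`, `Residual₅`, `datumOfRecord₅`, `densOfRecord₅`,
`upOfRecord₅`), `…B16NodeKnitRecord5` (module 5: `b16_main_of_rOperation_of_uvSlot`, `uvSlot_iff_atRecord₅`, `datumOfRecord₅_withGamma`,
`B16NodeKnit.uvSlot_of_cor3Leaves` through `b16_main_at_stage5Params_of_cor3Leaves`'s pattern), `…B14Cor3` (`ReprFamily`, `LeafH ∕ U1 ∕ U2 ∕ L1 ∕ L2`),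
`…Dag` (`B16_main` :253), `…DagBinding` (`leavesP`, `ROpLeaf`, `WorldP`).

WHY THE KNIT TRANSPORTS VERBATIM.  `IsRecordOfRecord₅C` differs from `IsRecordOfRecord₅` in ONE leaf of the upstream block: `b10 := DagDischarged.b10Compact`
([Balaban1985UV3] Thm 1 in the compact reading); every other leaf — in particular N13's first product `rOperation` — IS the N-binding's
(`Node00.upOfRecord₅C_leaves`, `rfl`), and N13's second product reads `w.C` only.  Module 5's knit proves N13 FROM ITS TWO PRODUCTS (the nine in-edge
antecedents, among them `b10`, are not used), so it holds at the C-binding record with the same displayed slots: (R₅) `ROpLeaf (θ.res.V P)` — [III]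
p. 244's property of the RESIDUAL 𝐑-carrier (what [Balaban1989LargeFieldII] Thm 1 delivers); (UV₅) the Cor.-3 slot at the densities of record
`densOfRecord₅ θ P k` (read at `θ.res.χ ∕ wilsonBG ∕ S218`, the forward-generated couplings `genSeq θ.res.βfun P.g0`, the world's exponent functions).
(The NODE STATEMENT itself does not transport between the two bindings — its `b10` antecedent differs —, only the product-level knit does.)

WHAT THIS FILE PROVES (0 `sorry`, 0 `def`, standard axioms).
§1 `rOperation_iff_rOpLeaf_res₅C` (at a world bound by the C-binding of record, `rOperation` IS `ROpLeaf (θ.res.V P)`); **`b16_main_at_stage5ParamsC`** (N13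
   at `(w, P)` from (R₅) + (UV₅) read at the record's objects); `b16_main_at_stage5ParamsC_of_cor3Leaves` ((UV₅) from a `B14Cor3.ReprFamily` of
   `(datumOfRecord₅ θ).C` with [III] p. 264's five leaves at `(w.γ, w.em, w.ep)`).
§2 **`b16_main_of_isRecordOfRecord₅C`** — THE KNIT AT THE PREDICATE OF RECORD; `b16_main_forall_isRecordOfRecord₅C` — the `S_N13 Rec₅C` shape
   `∀ D w, IsRecordOfRecord₅C F N D w → ∀ P, Dag.B16_main (leavesP w P)` from the slots stated once over all admissible `θ`; `…_of_cor3Leaves` twins.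
§3 DESIGN E at the predicate of record: `isRecordOfRecord₅C_reExp`, `upOfRecord₅C_withGamma`, `isRecordOfRecord₅C_withGamma` (the predicate of record
   reads neither `w.em, w.ep` nor, given `D`, the value of `w.γ`); **`s_N13E_shape_of_slots₅C`** — the dagwriter's `S_N13E Rec₅C` shape from datum-indexed
   exponent families and the slots for every parameter of the datum and every `γ`; `s_N13E_shape_of_slots₅C_gamma` (γ chosen at the datum too);
   **`s_N13E_threshold_shape_of_slots₅C`** — THE SHAPE THIS SEAT RECOMMENDS for the child: `∃ γ₁ > 0, ∃ e₋ e₊` after the datum, N13 at every record world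
   with `w.γ ≤ γ₁` carrying `e∓` ([III] Cor. 3 is printed «under the assumptions of Theorem 1», i.e. below Thm 1's `γ`; the leaves at `γ₁` restrict to every
   `w.γ ≤ γ₁` by `B14Cor3.leaves_restrict`); `b16_main_reExp_of_isRecordOfRecord₅C`.

HONEST FRAMING.  A count-neutral SLOT landing (R429 (4)(i)): N13 is NOT discharged — (R₅) and (UV₅) are displayed hypotheses (what [Balaban1989LargeFieldII]
Thm 1 ∕ Cor. 3 prove), statable in closed form once Stages 6–8 replace the residual fields; nothing of Bałaban's asserted or proved here; one finite
four-torus programme at fixed `ε`, Bałaban AS PRINTED with locators; nothing continuum ∕ ℝ⁴ ∕ OS ∕ mass gap ∕ Clay.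
-/

noncomputable section

namespace Literature.MathematicalPhysics.QuantumFieldTheory.Balaban1983to89.B16NodeKnitRecord5C

open DagBinding T4DatumAssembly T4Continuum Node00 FlowStepRuns
open B16NodeKnitRecord5 (b16_main_of_rOperation_of_uvSlot uvSlot_iff_atRecord₅ datumOfRecord₅_withGamma)

variable (F : T4Family) (N : ℕ) [NeZero N]

/-! ## §1. At the Stage-5 parameters `θ`, C-binding: a world bound to `datumOfRecord₅ θ` with `w.up P = upOfRecord₅C θ P` -/

section AtParams

variable (θ : Stage5Params F N) (w : WorldP) (P : B12.RunParams)

/-- At a world whose upstream block at `P` is the record's C-BINDING, N13's first product `rOperation` IS [III] p. 244's property of the RESIDUAL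
𝐑-carrier, `ROpLeaf (θ.res.V P)` — the C-binding touches `b10` only (`Node00.upOfRecord₅C_leaves`; definitional). [cite: Balaban1988Convergent, p.244 (the assumed 𝐑; bookkeeping)] -/
theorem rOperation_iff_rOpLeaf_res₅C (hup : w.up P = upOfRecord₅C F N θ P) :
    (leavesP w P).rOperation ↔ ROpLeaf (θ.res.V P) := by
  show (w.up P).rOperation ↔ _
  rw [hup]
  exact Iff.rfl

/-- **N13 AT THE STAGE-5 PARAMETERS `θ`, C-BINDING** ([Balaban1989LargeFieldII] Thm 1 p. 355 + Cor. 3): for a world bound to the datum of record at `θ`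
(`hC`) whose upstream block at the run `P` is the record's C-binding (`hup`), `Dag.B16_main (leavesP w P)` follows from the node's two OWN products read
at the record's objects — (R₅) `hR : ROpLeaf (θ.res.V P)`; (UV₅) `huv`, the Cor.-3 slot at the densities of record (module 5's `uvSlot_iff_atRecord₅`).
Both HYPOTHESES; count-neutral. [cite: Balaban1989LargeFieldII, Thm 1 p.355, p.387, p.391; Balaban1988Convergent, p.244, Cor. 3 (2.50) p.264] -/
theorem b16_main_at_stage5ParamsC (hC : w.C = (datumOfRecord₅ F N θ).C) (hup : w.up P = upOfRecord₅C F N θ P)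
    (hR : ROpLeaf (θ.res.V P))
    (huv : ((genFlow θ.res.βfun P.g0).InInterval w.γ P.K → ∀ k, k ≤ P.K → θ.res.S218 P k (densOfRecord₅ F N θ P k)) →
      (genFlow θ.res.βfun P.g0).InInterval w.γ P.K → ∀ k, k ≤ P.K → ∀ U : cfgOfRecord F N P.K k,
        θ.res.χ P k U * Real.exp (-(1 / (genSeq θ.res.βfun P.g0 k) ^ 2 * θ.res.wilsonBG P k U)
            - w.em (genSeq θ.res.βfun P.g0 k) * (Fintype.card (Site (F.P P.K) k) : ℝ)) ≤ densOfRecord₅ F N θ P k U ∧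
        densOfRecord₅ F N θ P k U ≤ Real.exp (w.ep (genSeq θ.res.βfun P.g0 k) * (Fintype.card (Site (F.P P.K) k) : ℝ))) :
    Dag.B16_main (leavesP w P) :=
  b16_main_of_rOperation_of_uvSlot w P ((rOperation_iff_rOpLeaf_res₅C F N θ w P hup).2 hR)
    ((uvSlot_iff_atRecord₅ F N θ w P hC).2 huv)

/-- **(UV₅) from a representation family of the datum's construction and [III] p. 264's five leaves** (`B16NodeKnit.uvSlot_of_cor3Leaves` at
`(datumOfRecord₅ θ).C`, interval `w.γ`, exponent functions `w.ep ∕ w.em`): with (R₅), N13 at `(w, P)`, C-binding. [cite: Balaban1988Convergent, Cor. 3 (2.50) p.264; Balaban1989LargeFieldII, Thm 1 p.355, p.387] -/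
theorem b16_main_at_stage5ParamsC_of_cor3Leaves (hC : w.C = (datumOfRecord₅ F N θ).C) (hup : w.up P = upOfRecord₅C F N θ P)
    (hR : ROpLeaf (θ.res.V P)) (R : B14Cor3.ReprFamily (datumOfRecord₅ F N θ).C)
    (hH : B14Cor3.LeafH (datumOfRecord₅ F N θ).C R w.γ) (hU1 : B14Cor3.LeafU1 (datumOfRecord₅ F N θ).C R w.γ)
    (hU2 : B14Cor3.LeafU2 (datumOfRecord₅ F N θ).C R w.γ w.ep) (hL1 : B14Cor3.LeafL1 (datumOfRecord₅ F N θ).C R w.γ)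
    (hL2 : B14Cor3.LeafL2 (datumOfRecord₅ F N θ).C R w.γ w.em) :
    Dag.B16_main (leavesP w P) := by
  refine b16_main_of_rOperation_of_uvSlot w P ((rOperation_iff_rOpLeaf_res₅C F N θ w P hup).2 hR) ?_
  obtain ⟨C, γ, em, ep, βup, β₀, β₀_pos, b, b_pos, L, one_lt_L, gR, up⟩ := w
  cases hC
  exact B16NodeKnit.uvSlot_of_cor3Leaves _ R hH hU1 hU2 hL1 hL2 P

end AtParams

/-! ## §2. At the record predicate of record `IsRecordOfRecord₅C F N D w` -/

section AtRecord

variable {F N}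
variable {D : FiniteEpsData F (SU N)} {w : WorldP}

/-- **N13 AT NODE 00's STAGE-5 RECORD OF RECORD, KNIT BY NAME** ([Balaban1989LargeFieldII] Thm 1 p. 355 + (0.1), Cor. 3 pp. 387 ∕ 391): if `(D, w)`
is a record (`IsRecordOfRecord₅C F N D w`) and, for the parameters of the record — every admissible `θ` with `D = datumOfRecord₅ θ` and `w.up = upOfRecord₅C θ`
— every run carries (R₅) [III] p. 244's property of the residual 𝐑-carrier and (UV₅) the Cor.-3 slot at the densities of record, then N13 holds at every run.
Count-neutral slot landing; both slots HYPOTHESES. [cite: Balaban1989LargeFieldII, Thm 1 p.355, p.387, p.391; Balaban1988Convergent, p.244, Cor. 3 (2.50) p.264] -/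
theorem b16_main_of_isRecordOfRecord₅C (h : IsRecordOfRecord₅C F N D w)
    (slots : ∀ θ : Stage5Params F N, θ.Admissible → D = datumOfRecord₅ F N θ →
      (∀ P, w.up P = upOfRecord₅C F N θ P) → ∀ P : B12.RunParams,
        ROpLeaf (θ.res.V P) ∧
        (((genFlow θ.res.βfun P.g0).InInterval w.γ P.K → ∀ k, k ≤ P.K → θ.res.S218 P k (densOfRecord₅ F N θ P k)) →
          (genFlow θ.res.βfun P.g0).InInterval w.γ P.K → ∀ k, k ≤ P.K → ∀ U : cfgOfRecord F N P.K k,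
            θ.res.χ P k U * Real.exp (-(1 / (genSeq θ.res.βfun P.g0 k) ^ 2 * θ.res.wilsonBG P k U)
                - w.em (genSeq θ.res.βfun P.g0 k) * (Fintype.card (Site (F.P P.K) k) : ℝ)) ≤ densOfRecord₅ F N θ P k U ∧
            densOfRecord₅ F N θ P k U ≤ Real.exp (w.ep (genSeq θ.res.βfun P.g0 k) * (Fintype.card (Site (F.P P.K) k) : ℝ)))) :
    ∀ P : B12.RunParams, Dag.B16_main (leavesP w P) := by
  intro P
  obtain ⟨θ, hθ, hD, hC, -, -, hup⟩ := h
  obtain ⟨hR, huv⟩ := slots θ hθ hD hup P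
  exact b16_main_at_stage5ParamsC F N θ w P (by rw [hC, hD]) (hup P) hR huv

/-- **The same with (UV₅) from [III] p. 264's five leaves** over a representation family of `D.C` on the world's interval with the world's exponent
functions, and (R₅) for the parameters of the record. [cite: Balaban1989LargeFieldII, Thm 1 p.355, p.387; Balaban1988Convergent, p.244, Cor. 3 (2.50) p.264] -/
theorem b16_main_of_isRecordOfRecord₅C_of_cor3Leaves (h : IsRecordOfRecord₅C F N D w)
    (hR : ∀ θ : Stage5Params F N, θ.Admissible → D = datumOfRecord₅ F N θ →
      (∀ P, w.up P = upOfRecord₅C F N θ P) → ∀ P : B12.RunParams, ROpLeaf (θ.res.V P))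
    (R : B14Cor3.ReprFamily D.C) (hH : B14Cor3.LeafH D.C R w.γ) (hU1 : B14Cor3.LeafU1 D.C R w.γ) (hU2 : B14Cor3.LeafU2 D.C R w.γ w.ep)
    (hL1 : B14Cor3.LeafL1 D.C R w.γ) (hL2 : B14Cor3.LeafL2 D.C R w.γ w.em) :
    ∀ P : B12.RunParams, Dag.B16_main (leavesP w P) := by
  intro P
  obtain ⟨θ, hθ, hD, hC, -, -, hup⟩ := h
  have hR' : ROpLeaf (θ.res.V P) := hR θ hθ hD hup P
  subst hD
  exact b16_main_at_stage5ParamsC_of_cor3Leaves F N θ w P hC (hup P) hR' R hH hU1 hU2 hL1 hL2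

/-- **The `S_N13 Rec₅C` shape** (dagwriter `YMDAG.UVSplit.S_N13` at the predicate of record): `∀ D w, IsRecordOfRecord₅C F N D w → ∀ P,
Dag.B16_main (leavesP w P)` from the two slots stated ONCE over all admissible `θ` at the worlds carrying the record's construction and C-binding.
(Such worlds carry arbitrary exponent functions `w.em, w.ep`: the design-E shape of §3 is the repaired child, cf. module 4 `B16NodeKnitExponents`.)
[cite: Balaban1989LargeFieldII, Thm 1 p.355 + p.391 (bookkeeping)] -/
theorem b16_main_forall_isRecordOfRecord₅C
    (slots : ∀ θ : Stage5Params F N, θ.Admissible → ∀ w : WorldP, w.C = (datumOfRecord₅ F N θ).C →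
      (∀ P, w.up P = upOfRecord₅C F N θ P) → ∀ P : B12.RunParams,
        ROpLeaf (θ.res.V P) ∧
        (((genFlow θ.res.βfun P.g0).InInterval w.γ P.K → ∀ k, k ≤ P.K → θ.res.S218 P k (densOfRecord₅ F N θ P k)) →
          (genFlow θ.res.βfun P.g0).InInterval w.γ P.K → ∀ k, k ≤ P.K → ∀ U : cfgOfRecord F N P.K k,
            θ.res.χ P k U * Real.exp (-(1 / (genSeq θ.res.βfun P.g0 k) ^ 2 * θ.res.wilsonBG P k U)
                - w.em (genSeq θ.res.βfun P.g0 k) * (Fintype.card (Site (F.P P.K) k) : ℝ)) ≤ densOfRecord₅ F N θ P k U ∧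
            densOfRecord₅ F N θ P k U ≤ Real.exp (w.ep (genSeq θ.res.βfun P.g0 k) * (Fintype.card (Site (F.P P.K) k) : ℝ)))) :
    ∀ (D : FiniteEpsData F (SU N)) (w : WorldP), IsRecordOfRecord₅C F N D w →
      ∀ P : B12.RunParams, Dag.B16_main (leavesP w P) := by
  intro D w h P
  obtain ⟨θ, hθ, hD, hC, -, -, hup⟩ := h
  obtain ⟨hR, huv⟩ := slots θ hθ w (by rw [hC, hD]) hup P
  exact b16_main_at_stage5ParamsC F N θ w P (by rw [hC, hD]) (hup P) hR huv

/-- **The `S_N13 Rec₅C` shape from the five Cor.-3 leaves** — supplied for EVERY `γ` and EVERY pair of exponent functions, since the predicate of record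
pins neither (`isRecordOfRecord₅C_withGamma`, `isRecordOfRecord₅C_reExp`). [cite: Balaban1989LargeFieldII, Thm 1 p.355 + p.391; Balaban1988Convergent, Cor. 3 (2.50) p.264 (bookkeeping)] -/
theorem b16_main_forall_isRecordOfRecord₅C_of_cor3Leaves
    (hR : ∀ θ : Stage5Params F N, θ.Admissible → ∀ P : B12.RunParams, ROpLeaf (θ.res.V P))
    (hcor : ∀ θ : Stage5Params F N, θ.Admissible → ∀ (γ : ℝ) (em ep : ℝ → ℝ),
      ∃ R : B14Cor3.ReprFamily (datumOfRecord₅ F N θ).C,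
        B14Cor3.LeafH (datumOfRecord₅ F N θ).C R γ ∧ B14Cor3.LeafU1 (datumOfRecord₅ F N θ).C R γ ∧
        B14Cor3.LeafU2 (datumOfRecord₅ F N θ).C R γ ep ∧ B14Cor3.LeafL1 (datumOfRecord₅ F N θ).C R γ ∧
        B14Cor3.LeafL2 (datumOfRecord₅ F N θ).C R γ em) :
    ∀ (D : FiniteEpsData F (SU N)) (w : WorldP), IsRecordOfRecord₅C F N D w →
      ∀ P : B12.RunParams, Dag.B16_main (leavesP w P) := by
  intro D w h P
  obtain ⟨θ, hθ, hD, hC, -, -, hup⟩ := h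
  obtain ⟨R, hH, hU1, hU2, hL1, hL2⟩ := hcor θ hθ w.γ w.em w.ep
  exact b16_main_at_stage5ParamsC_of_cor3Leaves F N θ w P (by rw [hC, hD]) (hup P) (hR θ hθ P) R hH hU1 hU2 hL1 hL2

end AtRecord

/-! ## §3. Design E at the predicate of record: the `S_N13E Rec₅C` shape -/

section DesignE

variable {F N}
variable {D : FiniteEpsData F (SU N)} {w : WorldP}

/-- The predicate of record does not read the exponent functions `w.em, w.ep` ([III] Cor. 3's conclusion letters). [cite: Balaban1988Convergent, Cor. 3 (2.50) p.264 (bookkeeping)] -/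
theorem isRecordOfRecord₅C_reExp (h : IsRecordOfRecord₅C F N D w) (em ep : ℝ → ℝ) :
    IsRecordOfRecord₅C F N D { w with em := em, ep := ep } := by
  obtain ⟨θ, hθ, hD, hC, hγ, hL, hup⟩ := h
  exact ⟨θ, hθ, hD, hC, hγ, hL, hup⟩

/-- Re-lettering the interval constant of the parameters does not change the C-binding of record (`rfl`). [cite: Balaban1989LargeFieldII, Thm 1 p.355 (bookkeeping)] -/
theorem upOfRecord₅C_withGamma (θ : Stage5Params F N) (γ : ℝ) (P : B12.RunParams) :
    upOfRecord₅C F N { θ with γ := γ } P = upOfRecord₅C F N θ P := rfl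

/-- **Nor does the predicate of record read the VALUE of the interval constant given the datum** (`θ.γ` enters neither `datumOfRecord₅ θ` nor
`upOfRecord₅C θ`): for every `γ > 0`, `{w with γ := γ}` is again a record over the SAME datum.  Kernel fact for the planners (design E): over one datum the
record worlds carry EVERY positive interval constant. [cite: Balaban1989LargeFieldII, Thm 1 p.355 («sufficiently small positive γ» — a letter the predicate quantifies, not pins; bookkeeping)] -/
theorem isRecordOfRecord₅C_withGamma (h : IsRecordOfRecord₅C F N D w) (γ : ℝ) (hγ : 0 < γ) :
    IsRecordOfRecord₅C F N D { w with γ := γ } := by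
  obtain ⟨θ, hθ, hD, hC, -, hL, hup⟩ := h
  exact ⟨{ θ with γ := γ }, ⟨hθ.1, hγ⟩, hD.trans (datumOfRecord₅_withGamma θ γ).symm, hC, rfl, hL,
    fun P => (hup P).trans (upOfRecord₅C_withGamma θ γ P).symm⟩

/-- **N13 AT THE RE-LETTERED RECORD WORLD** (design E, one world, C-binding): from datum-indexed exponent families `eM eP`, (R₅) for every parameter of
the datum, and [III] p. 264's five leaves of a representation family of `(datumOfRecord₅ θ).C` at `(w.γ, eM D, eP D)`, N13 at every run of the record world
`{w with em := eM D, ep := eP D}`. [cite: Balaban1989LargeFieldII, Thm 1 p.355, p.387, p.391; Balaban1988Convergent, Cor. 3 (2.50) p.264] -/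
theorem b16_main_reExp_of_isRecordOfRecord₅C (eM eP : FiniteEpsData F (SU N) → ℝ → ℝ) (h : IsRecordOfRecord₅C F N D w)
    (hR : ∀ θ : Stage5Params F N, θ.Admissible → D = datumOfRecord₅ F N θ → ∀ P : B12.RunParams, ROpLeaf (θ.res.V P))
    (hcor : ∀ θ : Stage5Params F N, θ.Admissible → D = datumOfRecord₅ F N θ →
      ∃ R : B14Cor3.ReprFamily (datumOfRecord₅ F N θ).C,
        B14Cor3.LeafH (datumOfRecord₅ F N θ).C R w.γ ∧ B14Cor3.LeafU1 (datumOfRecord₅ F N θ).C R w.γ ∧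
        B14Cor3.LeafU2 (datumOfRecord₅ F N θ).C R w.γ (eP D) ∧ B14Cor3.LeafL1 (datumOfRecord₅ F N θ).C R w.γ ∧
        B14Cor3.LeafL2 (datumOfRecord₅ F N θ).C R w.γ (eM D)) :
    ∀ P : B12.RunParams, Dag.B16_main (leavesP { w with em := eM D, ep := eP D } P) := by
  intro P
  obtain ⟨θ, hθ, hD, hC, -, -, hup⟩ := h
  obtain ⟨R, hH, hU1, hU2, hL1, hL2⟩ := hcor θ hθ hD
  have hR' : ROpLeaf (θ.res.V P) := hR θ hθ hD P
  exact b16_main_at_stage5ParamsC_of_cor3Leaves F N θ { w with em := eM D, ep := eP D } P (by rw [← hD]; exact hC) (hup P)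
    hR' R hH hU1 hU2 hL1 hL2

/-- **THE `S_N13E Rec₅C` SHAPE AT THE PREDICATE OF RECORD** (dagwriter g80 `YMDAG.UVSplit.S_N13E`, design E: [III] Cor. 3's *"constants E₋, E₊ … depending on
g_k"* chosen AFTER the datum, BEFORE the world and the run): from datum-indexed exponent families `eM eP` with, for every admissible parameter `θ`, (R₅) at
every run and, for EVERY interval constant `γ` (`isRecordOfRecord₅C_withGamma`), a representation family of `(datumOfRecord₅ θ).C` with [III] p. 264's five leaves
at `(γ, eM (datumOfRecord₅ θ), eP (datumOfRecord₅ θ))`.  Witness `eM D, eP D`.  Every displayed hypothesis is what [Balaban1989LargeFieldII] proves (Thm 1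
for 𝐑; Cor. 3 via the (1.89)-improved bound and the (1.90) gas, typed one-run-one-step in `B16Cor3CurlyGas`) — HYPOTHESES here; count-neutral.
[cite: Balaban1989LargeFieldII, Thm 1 p.355, p.387, p.391; Balaban1988Convergent, p.244, Cor. 3 (2.50) p.264] -/
theorem s_N13E_shape_of_slots₅C (eM eP : FiniteEpsData F (SU N) → ℝ → ℝ)
    (hR : ∀ θ : Stage5Params F N, θ.Admissible → ∀ P : B12.RunParams, ROpLeaf (θ.res.V P))
    (hcor : ∀ θ : Stage5Params F N, θ.Admissible → ∀ γ : ℝ,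
      ∃ R : B14Cor3.ReprFamily (datumOfRecord₅ F N θ).C,
        B14Cor3.LeafH (datumOfRecord₅ F N θ).C R γ ∧ B14Cor3.LeafU1 (datumOfRecord₅ F N θ).C R γ ∧
        B14Cor3.LeafU2 (datumOfRecord₅ F N θ).C R γ (eP (datumOfRecord₅ F N θ)) ∧ B14Cor3.LeafL1 (datumOfRecord₅ F N θ).C R γ ∧
        B14Cor3.LeafL2 (datumOfRecord₅ F N θ).C R γ (eM (datumOfRecord₅ F N θ))) :
    ∀ D : FiniteEpsData F (SU N), (∃ w : WorldP, IsRecordOfRecord₅C F N D w) →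
      ∃ em ep : ℝ → ℝ, ∀ w : WorldP, IsRecordOfRecord₅C F N D w → w.em = em → w.ep = ep →
        ∀ P : B12.RunParams, Dag.B16_main (leavesP w P) := by
  intro D _
  refine ⟨eM D, eP D, fun w h hem hep P => ?_⟩
  obtain ⟨θ, hθ, hD, hC, -, -, hup⟩ := h
  obtain ⟨R, hH, hU1, hU2, hL1, hL2⟩ := hcor θ hθ w.γ
  subst hD
  rw [← hem] at hL2
  rw [← hep] at hU2
  exact b16_main_at_stage5ParamsC_of_cor3Leaves F N θ w P hC (hup P) (hR θ hθ P) R hH hU1 hU2 hL1 hL2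

/-- **Design E with the interval constant ALSO chosen at the datum**: exponent families `eM eP D γ`, the five leaves at `(γ, eM D γ, eP D γ)` for every parameter
of `D`, give `∀ D γ, ∃ em ep, ∀ w, Rec₅C D w → w.γ = γ → w.em = em → w.ep = ep → ∀ P, N13`.  Located alternative for the planners, not a recommendation.
[cite: Balaban1989LargeFieldII, Thm 1 p.355; Balaban1988Convergent, Cor. 3 (2.50) p.264 (bookkeeping)] -/
theorem s_N13E_shape_of_slots₅C_gamma (eM eP : FiniteEpsData F (SU N) → ℝ → ℝ → ℝ)
    (hR : ∀ θ : Stage5Params F N, θ.Admissible → ∀ P : B12.RunParams, ROpLeaf (θ.res.V P))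
    (hcor : ∀ θ : Stage5Params F N, θ.Admissible → ∀ γ : ℝ,
      ∃ R : B14Cor3.ReprFamily (datumOfRecord₅ F N θ).C,
        B14Cor3.LeafH (datumOfRecord₅ F N θ).C R γ ∧ B14Cor3.LeafU1 (datumOfRecord₅ F N θ).C R γ ∧
        B14Cor3.LeafU2 (datumOfRecord₅ F N θ).C R γ (eP (datumOfRecord₅ F N θ) γ) ∧ B14Cor3.LeafL1 (datumOfRecord₅ F N θ).C R γ ∧
        B14Cor3.LeafL2 (datumOfRecord₅ F N θ).C R γ (eM (datumOfRecord₅ F N θ) γ)) :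
    ∀ (D : FiniteEpsData F (SU N)) (γ : ℝ),
      ∃ em ep : ℝ → ℝ, ∀ w : WorldP, IsRecordOfRecord₅C F N D w → w.γ = γ → w.em = em → w.ep = ep →
        ∀ P : B12.RunParams, Dag.B16_main (leavesP w P) := by
  intro D γ
  refine ⟨eM D γ, eP D γ, fun w h hγ hem hep P => ?_⟩
  obtain ⟨θ, hθ, hD, hC, -, -, hup⟩ := h
  obtain ⟨R, hH, hU1, hU2, hL1, hL2⟩ := hcor θ hθ γ
  subst hD
  subst hγ
  rw [← hem] at hL2
  rw [← hep] at hU2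
  exact b16_main_at_stage5ParamsC_of_cor3Leaves F N θ w P hC (hup P) (hR θ hθ P) R hH hU1 hU2 hL1 hL2

/-- **Design E WITH A THRESHOLD — the shape this seat recommends for the child `S_N13E`** ([III] Cor. 3 is printed *"Under the assumptions of
Theorem 1"*, i.e. for couplings in `]0, γ]` with the `γ` of Thm 1 — NOT for every interval constant; yet the predicate of record carries EVERY `γ > 0` over one
datum, `isRecordOfRecord₅C_withGamma`): `∀ D, (∃ w, Rec₅C D w) → ∃ γ₁ > 0, ∃ e₋ e₊, ∀ w, Rec₅C D w → w.γ ≤ γ₁ → w.em = e₋ → w.ep = e₊ → ∀ P, N13`.  It follows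
from datum-indexed thresholds `γ₁ D > 0` and exponent families `eM eP D` with, for every parameter `θ` of the datum, (R₅) at every run and ONE representation
family of `(datumOfRecord₅ θ).C` carrying [III] p. 264's five leaves at `(γ₁ D, eM D, eP D)` — the leaves RESTRICT to every `w.γ ≤ γ₁ D` (`B14Cor3.leaves_restrict`).
A glue in design E re-letters the world to `γ := min γ₀ γ₁` (β-side window `γ₀`), which `DagBinding.endStatementBPrinted_of_nodesP_interval`'s `w.γ ≤ γ₀`
accepts.  Located design input for the planners (dagwriter `S_N13E`, plan g60); every displayed hypothesis a HYPOTHESIS; count-neutral.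
[cite: Balaban1989LargeFieldII, Thm 1 p.355, p.387, p.391; Balaban1988Convergent, Cor. 3 (2.50) p.264 («Under the assumptions of Theorem 1»)] -/
theorem s_N13E_threshold_shape_of_slots₅C (γ₁ : FiniteEpsData F (SU N) → ℝ) (hγ₁ : ∀ D, 0 < γ₁ D)
    (eM eP : FiniteEpsData F (SU N) → ℝ → ℝ)
    (hR : ∀ θ : Stage5Params F N, θ.Admissible → ∀ P : B12.RunParams, ROpLeaf (θ.res.V P))
    (hcor : ∀ θ : Stage5Params F N, θ.Admissible →
      ∃ R : B14Cor3.ReprFamily (datumOfRecord₅ F N θ).C,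
        B14Cor3.LeafH (datumOfRecord₅ F N θ).C R (γ₁ (datumOfRecord₅ F N θ)) ∧
        B14Cor3.LeafU1 (datumOfRecord₅ F N θ).C R (γ₁ (datumOfRecord₅ F N θ)) ∧
        B14Cor3.LeafU2 (datumOfRecord₅ F N θ).C R (γ₁ (datumOfRecord₅ F N θ)) (eP (datumOfRecord₅ F N θ)) ∧
        B14Cor3.LeafL1 (datumOfRecord₅ F N θ).C R (γ₁ (datumOfRecord₅ F N θ)) ∧
        B14Cor3.LeafL2 (datumOfRecord₅ F N θ).C R (γ₁ (datumOfRecord₅ F N θ)) (eM (datumOfRecord₅ F N θ))) :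
    ∀ D : FiniteEpsData F (SU N), (∃ w : WorldP, IsRecordOfRecord₅C F N D w) →
      ∃ γ' : ℝ, 0 < γ' ∧ ∃ em ep : ℝ → ℝ, ∀ w : WorldP, IsRecordOfRecord₅C F N D w → w.γ ≤ γ' → w.em = em → w.ep = ep →
        ∀ P : B12.RunParams, Dag.B16_main (leavesP w P) := by
  intro D _
  refine ⟨γ₁ D, hγ₁ D, eM D, eP D, fun w h hγ hem hep P => ?_⟩
  obtain ⟨θ, hθ, hD, hC, -, -, hup⟩ := h
  obtain ⟨R, hH, hU1, hU2, hL1, hL2⟩ := hcor θ hθ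
  subst hD
  obtain ⟨hH', hU1', hU2', hL1', hL2'⟩ := B14Cor3.leaves_restrict _ R hγ _ _ hH hU1 hU2 hL1 hL2
  rw [← hem] at hL2'
  rw [← hep] at hU2'
  exact b16_main_at_stage5ParamsC_of_cor3Leaves F N θ w P hC (hup P) (hR θ hθ P) R hH' hU1' hU2' hL1' hL2'

end DesignE

end Literature.MathematicalPhysics.QuantumFieldTheory.Balaban1983to89.B16NodeKnitRecord5C

end
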